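import Summits.QuantumFields.QCD.Theses.SpectralDefectExtinction
import Literature.MathematicalPhysics.QuantumFieldTheory.WilsonSiteRPForm
import Literature.MathematicalPhysics.QuantumLattice.SpectralLocalizer
import Literature.MathematicalPhysics.QuantumLattice.OverlapLocality
import Literature.MathematicalPhysics.QuantumLattice.GrassmannIntegralWilsonProofs

/-!
# Negative lemmas for the crux `TipPricing` (item stmt-QuantumFields-8967), IVa: the time reflection is a
# similarity of `D_W` and an ANTI-similarity of `H_W = Γ₅ D_W` — it reverses the spectral index

Route `SpectralDefectExtinction` (QCD), crux `TipPricing : TipNoBinding → WegnerEstimate → WindowExtinction`.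
Refuter file (cdisprove seat, cycle 2): sorry-free, no definitions, no positive route-item conclusion;
configuration-wise linear algebra only (the measure-theoretic consequence — `E₊[n₋ − n/2] ≤ 0`, so the SIGNED
form of TIGHT is false for every witness — is the companion file `Negative/ReflectionSignedTight.lean`).
Certified copy of §10 (first half) of `Summits/QuantumFields/QCD/Cruxes/TipPricing/Disproof.lean`.

* Spin algebra of `𝔸 = γ₀γ₅`: flips `γ₀`, fixes the spatial `γ_j`, anticommutes with `γ₅` (`spinA_*`).
* `wilsonDirac_negReflect` (via `linkHop_*`, `wilsonHop_negReflect`): for the tree's time reflection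
  `Θ' = GaugeConfig.negReflect`, `D_W(Θ'U, m, 1) = θ (𝔸 D_W(U, m, 1) 𝔸⁻¹) θ` (site permutation `θ`; the reversal of
  the temporal links is compensated by the swap `P⁻₀ ↔ P⁺₀` under `𝔸`).
* `hermitianWilson_negReflect`: `H_W(Θ'U, m) = −θ (𝔸 H_W(U, m) 𝔸⁻¹) θ`, hence `negCount_hermitianWilson_negReflect`:
  `n₋(H_W(Θ'U, m)) = n₊(H_W(U, m))` for every field, torus, mass; `det_wilsonDirac_negReflect`: `det` is invariant.
References: Osterwalder–Seiler, Ann. Phys. 110 (1978) 440 §2; Montvay–Münster 1994 §4.2; EHN, NPB 535 (1998) 403.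
-/

noncomputable section

namespace Summit.QuantumFields.QCD.Theorems.TipPricing.Negative

open MeasureTheory
open Literature.MathematicalPhysics.QuantumFieldTheory
open Literature.MathematicalPhysics.QuantumFieldTheory.WilsonRP
open Literature.MathematicalPhysics.QuantumFieldTheory.WilsonSiteRP

/-! ## Spin algebra of the reflection: `𝔸 = γ₀ γ₅` flips `γ₀`, fixes `γ_j`, anticommutes with `γ₅` -/

section Spin

open Literature.MathematicalPhysics.QuantumLattice Literature.Probability.LatticeModels Matrix
open scoped Kronecker

/-- The spinor representative of the time reflection: `𝔸 = γ₀ γ₅`. -/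
local notation "𝔸" => (euclideanGamma 0 * gammaFive : Matrix (Fin 4) (Fin 4) ℂ)

/-- `γ₅ (γ_μ M) = −γ_μ (γ₅ M)`. -/
theorem gammaFive_mul_euclideanGamma_mul (μ : Fin 4) (M : Matrix (Fin 4) (Fin 4) ℂ) :
    gammaFive * (euclideanGamma μ * M) = -(euclideanGamma μ * (gammaFive * M)) := by
  rw [← Matrix.mul_assoc, gammaFive_mul_euclideanGamma, Matrix.neg_mul, Matrix.mul_assoc]

/-- `γ_μ (γ_ν M) = −γ_ν (γ_μ M)` for `μ ≠ ν`. -/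
theorem euclideanGamma_mul_euclideanGamma_mul {μ ν : Fin 4} (h : μ ≠ ν) (M : Matrix (Fin 4) (Fin 4) ℂ) :
    euclideanGamma μ * (euclideanGamma ν * M) = -(euclideanGamma ν * (euclideanGamma μ * M)) := by
  rw [← Matrix.mul_assoc, euclideanGamma_mul_of_ne h, Matrix.neg_mul, Matrix.mul_assoc]

/-- `γ_μ (γ_μ M) = M`. -/
theorem euclideanGamma_mul_euclideanGamma_mul_self (μ : Fin 4) (M : Matrix (Fin 4) (Fin 4) ℂ) :
    euclideanGamma μ * (euclideanGamma μ * M) = M := by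
  rw [← Matrix.mul_assoc, euclideanGamma_mul_self, Matrix.one_mul]

/-- `𝔸² = −1`. -/
theorem spinA_mul_spinA : 𝔸 * 𝔸 = -1 := by
  simp only [Matrix.mul_assoc]
  rw [gammaFive_mul_euclideanGamma_mul, Matrix.mul_neg, euclideanGamma_mul_euclideanGamma_mul_self,
    gammaFive_mul_self]

/-- `𝔸 γ₀ 𝔸 = γ₀` (so `𝔸 γ₀ 𝔸⁻¹ = −γ₀`: the time component flips). -/
theorem spinA_mul_gamma_zero_mul_spinA : 𝔸 * euclideanGamma 0 * 𝔸 = euclideanGamma 0 := by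
  simp only [Matrix.mul_assoc]
  rw [euclideanGamma_mul_euclideanGamma_mul_self, gammaFive_mul_self, Matrix.mul_one]

/-- `𝔸 γ_j 𝔸 = −γ_j` for a spatial direction `j ≠ 0` (so `𝔸 γ_j 𝔸⁻¹ = γ_j`). -/
theorem spinA_mul_gamma_mul_spinA {j : Fin 4} (hj : j ≠ 0) :
    𝔸 * euclideanGamma j * 𝔸 = -euclideanGamma j := by
  simp only [Matrix.mul_assoc]
  rw [gammaFive_mul_euclideanGamma_mul j, Matrix.mul_neg, gammaFive_mul_euclideanGamma_mul 0]
  simp only [Matrix.mul_neg, neg_neg]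
  rw [gammaFive_mul_self, Matrix.mul_one, euclideanGamma_mul_euclideanGamma_mul (Ne.symm hj)]
  rw [euclideanGamma_mul_self, Matrix.mul_one]

/-- `γ₅ 𝔸 = −𝔸 γ₅`: the reflection flips chirality. -/
theorem gammaFive_mul_spinA : gammaFive * 𝔸 = -(𝔸 * gammaFive) := by
  simp only [Matrix.mul_assoc]
  rw [gammaFive_mul_euclideanGamma_mul]

/-- Conjugating the time projectors swaps them: `𝔸 P⁻₀ (−𝔸) = P⁺₀`. -/
theorem spinA_conj_chiralProjMinus_zero :
    𝔸 * chiralProjMinus 0 * (-𝔸) = chiralProjPlus 0 := by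
  rw [chiralProjMinus, chiralProjPlus, Matrix.mul_smul, Matrix.smul_mul, Matrix.mul_sub,
    Matrix.sub_mul, Matrix.mul_one, Matrix.mul_neg, Matrix.mul_neg, spinA_mul_spinA,
    spinA_mul_gamma_zero_mul_spinA, neg_neg, sub_neg_eq_add]

/-- `𝔸 P⁺₀ (−𝔸) = P⁻₀`. -/
theorem spinA_conj_chiralProjPlus_zero :
    𝔸 * chiralProjPlus 0 * (-𝔸) = chiralProjMinus 0 := by
  rw [chiralProjMinus, chiralProjPlus, Matrix.mul_smul, Matrix.smul_mul, Matrix.mul_add,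
    Matrix.add_mul, Matrix.mul_one, Matrix.mul_neg, Matrix.mul_neg, spinA_mul_spinA,
    spinA_mul_gamma_zero_mul_spinA, neg_neg, ← sub_eq_add_neg]

/-- Spatial projectors are fixed: `𝔸 P⁻ⱼ (−𝔸) = P⁻ⱼ`. -/
theorem spinA_conj_chiralProjMinus {j : Fin 4} (hj : j ≠ 0) :
    𝔸 * chiralProjMinus j * (-𝔸) = chiralProjMinus j := by
  rw [chiralProjMinus, Matrix.mul_smul, Matrix.smul_mul, Matrix.mul_sub,
    Matrix.sub_mul, Matrix.mul_one, Matrix.mul_neg, Matrix.mul_neg, spinA_mul_spinA,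
    spinA_mul_gamma_mul_spinA hj, neg_neg, neg_neg]

/-- `𝔸 P⁺ⱼ (−𝔸) = P⁺ⱼ`. -/
theorem spinA_conj_chiralProjPlus {j : Fin 4} (hj : j ≠ 0) :
    𝔸 * chiralProjPlus j * (-𝔸) = chiralProjPlus j := by
  rw [chiralProjPlus, Matrix.mul_smul, Matrix.smul_mul, Matrix.mul_add,
    Matrix.add_mul, Matrix.mul_one, Matrix.mul_neg, Matrix.mul_neg, spinA_mul_spinA,
    spinA_mul_gamma_mul_spinA hj, neg_neg, neg_neg]

variable {L N : ℕ} [NeZero L]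

omit [NeZero L] in
/-- `spinorLift` as a re-associated Kronecker product with the identity on site ⊗ colour. -/
theorem spinorLift_eq_reindex (Γ : Matrix (Fin 4) (Fin 4) ℂ) :
    (spinorLift Γ : Matrix (TorusSite 4 L × Fin N × Fin 4) (TorusSite 4 L × Fin N × Fin 4) ℂ) =
      Matrix.reindex (Equiv.prodAssoc _ _ _) (Equiv.prodAssoc _ _ _)
        ((1 : Matrix (TorusSite 4 L × Fin N) (TorusSite 4 L × Fin N) ℂ) ⊗ₖ Γ) := by
  rw [← Matrix.one_kronecker_one, Matrix.kronecker_assoc]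
  rfl

/-- `spinorLift` is multiplicative. -/
theorem spinorLift_mul (A B : Matrix (Fin 4) (Fin 4) ℂ) :
    spinorLift (L := L) (N := N) A * spinorLift (L := L) (N := N) B = spinorLift (A * B) := by
  unfold spinorLift
  rw [← Matrix.mul_kronecker_mul, ← Matrix.mul_kronecker_mul, Matrix.mul_one, Matrix.mul_one]

omit [NeZero L] in
/-- `spinorLift 1 = 1`. -/
theorem spinorLift_one :
    (spinorLift 1 : Matrix (TorusSite 4 L × Fin N × Fin 4) (TorusSite 4 L × Fin N × Fin 4) ℂ) = 1 := by
  unfold spinorLift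
  rw [Matrix.one_kronecker_one, Matrix.one_kronecker_one]

omit [NeZero L] in
/-- `spinorLift (−A) = −spinorLift A`. -/
theorem spinorLift_neg (A : Matrix (Fin 4) (Fin 4) ℂ) :
    (spinorLift (-A) : Matrix (TorusSite 4 L × Fin N × Fin 4) (TorusSite 4 L × Fin N × Fin 4) ℂ) =
      -spinorLift A := by
  ext p q
  simp [spinorLift, Matrix.kroneckerMap_apply]

/-- **Conjugating a re-associated Kronecker product by spinor lifts acts on the spin factor only.** -/
theorem spinorLift_mul_reindex_kronecker_mul_spinorLift (A B Y : Matrix (Fin 4) (Fin 4) ℂ)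
    (X : Matrix (TorusSite 4 L × Fin N) (TorusSite 4 L × Fin N) ℂ) :
    spinorLift (L := L) (N := N) A *
        Matrix.reindex (Equiv.prodAssoc _ _ _) (Equiv.prodAssoc _ _ _) (X ⊗ₖ Y) *
          spinorLift (L := L) (N := N) B =
      Matrix.reindex (Equiv.prodAssoc _ _ _) (Equiv.prodAssoc _ _ _) (X ⊗ₖ (A * Y * B)) := by
  rw [spinorLift_eq_reindex, spinorLift_eq_reindex]
  simp only [Matrix.reindex_apply, Matrix.submatrix_mul_equiv, ← Matrix.mul_kronecker_mul,
    Matrix.one_mul, Matrix.mul_one]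

end Spin

/-! ## The reflection on indices, links and the Wilson hopping matrices -/

section LinkReflect

open Literature.MathematicalPhysics.QuantumLattice Literature.Probability.LatticeModels Matrix
open scoped Kronecker

variable {L N : ℕ} [NeZero L] {G : Type*} [Group G] (ρ : G →* Matrix (Fin N) (Fin N) ℂ)

/-- The spinor representative of the time reflection: `𝔸 = γ₀ γ₅`. -/
local notation "𝔸" => (euclideanGamma 0 * gammaFive : Matrix (Fin 4) (Fin 4) ℂ)

/-- The time reflection of sites as a permutation of the four-torus. -/
local notation "θS" => (Function.Involutive.toPerm (Site.negReflect (d := 4) (L := L))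
  (fun x => WilsonSiteRP.negReflect_negReflect x) : Equiv.Perm (TorusSite 4 L))

/-- The time reflection on site ⊗ colour indices. -/
local notation "θQ" => (Equiv.prodCongr θS (Equiv.refl (Fin N)) :
  Equiv.Perm (TorusSite 4 L × Fin N))

/-- The time reflection on site ⊗ colour ⊗ spin indices. -/
local notation "θI" => (Equiv.prodCongr θS (Equiv.refl (Fin N × Fin 4)) :
  Equiv.Perm (TorusSite 4 L × Fin N × Fin 4))

omit [NeZero L] in
/-- Unfolding the site-reflection permutation. -/
theorem thetaS_apply (x : TorusSite 4 L) : (θS) x = Site.negReflect x := rfl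

omit [NeZero L] in
/-- Re-associated Kronecker products commute with the site reflection (which acts on the first
factor only). -/
theorem submatrix_reindex_kronecker (X : Matrix (TorusSite 4 L × Fin N) (TorusSite 4 L × Fin N) ℂ)
    (Y : Matrix (Fin 4) (Fin 4) ℂ) :
    (Matrix.reindex (Equiv.prodAssoc _ _ _) (Equiv.prodAssoc _ _ _) (X ⊗ₖ Y)).submatrix θI θI =
      Matrix.reindex (Equiv.prodAssoc _ _ _) (Equiv.prodAssoc _ _ _) ((X.submatrix θQ θQ) ⊗ₖ Y) := by
  ext ⟨x, a, α⟩ ⟨y, b, β⟩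
  rfl

omit [NeZero L] in
/-- `reindex` is additive. -/
theorem reindex_add' {m n : Type*} (e : m ≃ n) (A B : Matrix m m ℂ) :
    Matrix.reindex e e (A + B) = Matrix.reindex e e A + Matrix.reindex e e B := rfl

omit [NeZero L] in
/-- `submatrix` is additive. -/
theorem submatrix_add' {m n : Type*} (f : m → n) (A B : Matrix n n ℂ) :
    (A + B).submatrix f f = A.submatrix f f + B.submatrix f f := rfl

omit [NeZero L] in
/-- **Spatial links are carried along**: `F_j(Θ'U) = θ F_j(U) θ` for `j ≠ 0`. -/
theorem linkHop_negReflect_of_ne (U : GaugeConfig 4 L G) {j : Fin 4} (hj : j ≠ 0) :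
    linkHop ρ U.negReflect j = (linkHop ρ U j).submatrix θQ θQ := by
  ext ⟨x, a⟩ ⟨y, b⟩
  simp only [linkHop, Matrix.submatrix_apply, Matrix.of_apply, Equiv.prodCongr_apply, Prod.map,
    Equiv.coe_refl, id_eq, thetaS_apply]
  have hU : U.negReflect (x, j) = U (Site.negReflect x, j) := by
    simp only [GaugeConfig.negReflect, hj, ↓reduceIte]
  have hiff : y = Site.shift x j ↔ Site.negReflect y = Site.shift (Site.negReflect x) j := by
    rw [← WilsonSiteRP.negReflect_shift_of_ne x hj]
    constructor
    · intro h; rw [h]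
    · intro h
      have h2 := congrArg Site.negReflect h
      simpa only [WilsonSiteRP.negReflect_negReflect] using h2
  by_cases h : y = Site.shift x j
  · rw [if_pos h, if_pos (hiff.mp h), hU]
  · rw [if_neg h, if_neg (mt hiff.mpr h)]

omit [NeZero L] in
/-- **Temporal links are reversed**: `F₀(Θ'U) = θ F₀(U)ᴴ θ` (unitary colour representation). -/
theorem linkHop_negReflect_zero (hρ : ∀ g, ρ g ∈ Matrix.unitaryGroup (Fin N) ℂ)
    (U : GaugeConfig 4 L G) :
    linkHop ρ U.negReflect 0 = ((linkHop ρ U 0)ᴴ).submatrix θQ θQ := by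
  ext ⟨x, a⟩ ⟨y, b⟩
  simp only [linkHop, Matrix.submatrix_apply, Matrix.conjTranspose_apply, Matrix.of_apply,
    Equiv.prodCongr_apply, Prod.map, Equiv.coe_refl, id_eq, thetaS_apply, star_ite_zero]
  have hU : U.negReflect (x, 0) = (U (Site.negReflect (Site.shift x 0), 0))⁻¹ := by
    simp only [GaugeConfig.negReflect, ↓reduceIte]
  have hiff : y = Site.shift x 0 ↔ Site.negReflect x = Site.shift (Site.negReflect y) 0 := by
    constructor
    · intro h; rw [h, WilsonSiteRP.negReflect_shift_shift]
    · intro h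
      have h2 := congrArg (fun z => (Site.negReflect (d := 4) z).shift 0) h
      simp only [WilsonSiteRP.negReflect_negReflect, WilsonSiteRP.negReflect_shift_shift] at h2
      exact h2.symm
  by_cases h : y = Site.shift x 0
  · rw [if_pos h, if_pos (hiff.mp h), hU, star_rep_apply ρ hρ, h]
  · rw [if_neg h, if_neg (mt hiff.mpr h)]

/-- **The Wilson hopping matrices of the reflected field** are the spin-conjugated, site-reflected
hopping matrices of the field: `W_μ(Θ'U) = θ (𝔸 W_μ(U) 𝔸⁻¹) θ` (the time projectors `P^∓₀` are
swapped by `𝔸`, compensating the reversal of the temporal links). -/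
theorem wilsonHop_negReflect (hρ : ∀ g, ρ g ∈ Matrix.unitaryGroup (Fin N) ℂ)
    (U : GaugeConfig 4 L G) (μ : Fin 4) :
    wilsonHop ρ U.negReflect μ =
      (spinorLift (L := L) (N := N) 𝔸 * wilsonHop ρ U μ * spinorLift (-𝔸)).submatrix θI θI := by
  by_cases hμ : μ = 0
  · subst hμ
    rw [wilsonHop, wilsonHop, linkHop_negReflect_zero ρ hρ U, Matrix.conjTranspose_submatrix,
      Matrix.conjTranspose_conjTranspose, reindex_add', reindex_add', Matrix.mul_add, Matrix.add_mul,
      spinorLift_mul_reindex_kronecker_mul_spinorLift, spinorLift_mul_reindex_kronecker_mul_spinorLift,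
      spinA_conj_chiralProjMinus_zero, spinA_conj_chiralProjPlus_zero, submatrix_add',
      submatrix_reindex_kronecker, submatrix_reindex_kronecker, add_comm]
  · rw [wilsonHop, wilsonHop, linkHop_negReflect_of_ne ρ U hμ, Matrix.conjTranspose_submatrix,
      reindex_add', reindex_add', Matrix.mul_add, Matrix.add_mul,
      spinorLift_mul_reindex_kronecker_mul_spinorLift, spinorLift_mul_reindex_kronecker_mul_spinorLift,
      spinA_conj_chiralProjMinus hμ, spinA_conj_chiralProjPlus hμ, submatrix_add',
      submatrix_reindex_kronecker, submatrix_reindex_kronecker]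

omit [NeZero L] in
/-- `submatrix` distributes over subtraction. -/
theorem submatrix_sub' {m n : Type*} (f : m → n) (A B : Matrix n n ℂ) :
    (A - B).submatrix f f = A.submatrix f f - B.submatrix f f := rfl

omit [NeZero L] in
/-- `submatrix` commutes with negation. -/
theorem submatrix_neg' {m n : Type*} (f : m → n) (A : Matrix n n ℂ) :
    (-A).submatrix f f = -(A.submatrix f f) := rfl

omit [NeZero L] in
/-- `submatrix` commutes with scalars. -/
theorem submatrix_smul' {m n : Type*} (f : m → n) (c : ℂ) (A : Matrix n n ℂ) :
    (c • A).submatrix f f = c • A.submatrix f f := rfl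

omit [NeZero L] in
/-- `submatrix` distributes over finite sums. -/
theorem submatrix_sum' {m n ι : Type*} (s : Finset ι) (f : m → n) (A : ι → Matrix n n ℂ) :
    (∑ i ∈ s, A i).submatrix f f = ∑ i ∈ s, (A i).submatrix f f := by
  ext a b
  simp only [Matrix.submatrix_apply, Matrix.sum_apply]

/-- `𝔸 (−𝔸) = 1`. -/
theorem spinA_mul_neg_spinA : 𝔸 * (-𝔸) = 1 := by
  rw [Matrix.mul_neg, spinA_mul_spinA, neg_neg]

/-- `(−𝔸) 𝔸 = 1`. -/
theorem neg_spinA_mul_spinA : (-𝔸) * 𝔸 = 1 := by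
  rw [Matrix.neg_mul, spinA_mul_spinA, neg_neg]

/-- **The Wilson–Dirac operator of the reflected field** (`r = 1`, unitary colour representation):
`D_W(Θ'U, m) = θ (𝔸 D_W(U, m) 𝔸⁻¹) θ` — a similarity. -/
theorem wilsonDirac_negReflect (hρ : ∀ g, ρ g ∈ Matrix.unitaryGroup (Fin N) ℂ)
    (U : GaugeConfig 4 L G) (m : ℝ) :
    wilsonDirac ρ U.negReflect m 1 =
      (spinorLift (L := L) (N := N) 𝔸 * wilsonDirac ρ U m 1 * spinorLift (-𝔸)).submatrix θI θI := by
  rw [wilsonDirac_eq_sub_sum_wilsonHop ρ hρ, wilsonDirac_eq_sub_sum_wilsonHop ρ hρ, Matrix.mul_sub,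
    Matrix.sub_mul, Matrix.mul_smul, Matrix.mul_one, Matrix.smul_mul, spinorLift_mul, Finset.mul_sum,
    Finset.sum_mul, submatrix_sub', submatrix_smul', submatrix_sum', spinA_mul_neg_spinA, spinorLift_one,
    Matrix.submatrix_one_equiv]
  congr 1
  exact Finset.sum_congr rfl fun μ _ => wilsonHop_negReflect ρ hρ U μ

omit [NeZero L] in
/-- `Γ₅` is fixed by the site reflection. -/
theorem spinorLift_gammaFive_submatrix :
    (spinorLift (L := L) (N := N) gammaFive).submatrix θI θI = spinorLift gammaFive := by
  rw [spinorLift_eq_reindex, submatrix_reindex_kronecker, Matrix.submatrix_one_equiv]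

/-- **The Hermitian Wilson–Dirac operator of the reflected field is MINUS a similarity transform of
the original**: `H_W(Θ'U, m) = −θ (𝔸 H_W(U, m) 𝔸⁻¹) θ` (`γ₅ 𝔸 = −𝔸 γ₅`). -/
theorem hermitianWilson_negReflect (hρ : ∀ g, ρ g ∈ Matrix.unitaryGroup (Fin N) ℂ)
    (U : GaugeConfig 4 L G) (m : ℝ) :
    spinorLift gammaFive * wilsonDirac ρ U.negReflect m 1 =
      -((spinorLift (L := L) (N := N) 𝔸 * (spinorLift gammaFive * wilsonDirac ρ U m 1) *
          spinorLift (-𝔸)).submatrix θI θI) := by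
  rw [wilsonDirac_negReflect ρ hρ U m]
  conv_lhs => rw [← spinorLift_gammaFive_submatrix (L := L) (N := N)]
  rw [Matrix.submatrix_mul_equiv, ← submatrix_neg']
  congr 1
  rw [← Matrix.mul_assoc, ← Matrix.mul_assoc, spinorLift_mul, gammaFive_mul_spinA, spinorLift_neg,
    ← spinorLift_mul]
  simp only [Matrix.neg_mul, Matrix.mul_assoc]

omit [NeZero L] in
/-- `χ_K(−X) = (−1)ⁿ χ_{−K}(X)`. -/
theorem charpoly_comp_neg_X {n : Type*} [Fintype n] [DecidableEq n] (K : Matrix n n ℂ) :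
    K.charpoly.comp (-Polynomial.X) = (-1) ^ Fintype.card n * (-K).charpoly := by
  have h1 : K.charpoly.comp (-Polynomial.X) =
      (Polynomial.compRingHom (-Polynomial.X : Polynomial ℂ)) K.charpoly := rfl
  have h2 : (Polynomial.compRingHom (-Polynomial.X : Polynomial ℂ)).mapMatrix (charmatrix K) =
      -charmatrix (-K) := by
    ext i j : 1
    rw [RingHom.mapMatrix_apply, Matrix.map_apply, Matrix.neg_apply]
    by_cases hij : i = j
    · subst hij
      rw [charmatrix_apply_eq, charmatrix_apply_eq, Polynomial.coe_compRingHom_apply,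
        Polynomial.sub_comp, Polynomial.X_comp, Polynomial.C_comp, Matrix.neg_apply, map_neg]
      ring
    · rw [charmatrix_apply_ne _ _ _ hij, charmatrix_apply_ne _ _ _ hij,
        Polynomial.coe_compRingHom_apply, Polynomial.neg_comp, Polynomial.C_comp, Matrix.neg_apply,
        map_neg, neg_neg]
  rw [h1, Matrix.charpoly, RingHom.map_det, h2, Matrix.det_neg, Matrix.charpoly]

omit [NeZero L] in
/-- **Roots of `χ_{−K}` are the negatives of the roots of `χ_K`.** -/
theorem roots_charpoly_neg {n : Type*} [Fintype n] [DecidableEq n] (K : Matrix n n ℂ) :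
    (-K).charpoly.roots = K.charpoly.roots.map fun z => -z := by
  have h := charpoly_comp_neg_X K
  have hC : ((-1 : Polynomial ℂ) ^ Fintype.card n) = Polynomial.C ((-1 : ℂ) ^ Fintype.card n) := by
    simp
  have h2 : (((-1 : Polynomial ℂ) ^ Fintype.card n) * (-K).charpoly).roots = (-K).charpoly.roots := by
    rw [hC, ← Polynomial.smul_eq_C_mul,
      Polynomial.roots_smul_nonzero _ (pow_ne_zero _ (neg_ne_zero.mpr one_ne_zero))]
  rw [← h2, ← h, Polynomial.roots_comp_neg_X]

/-- **The reflection flips the spectral index**: the number of NEGATIVE eigenvalues of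
`H_W(Θ'U, m) = Γ₅ D_W(Θ'U, m, 1)` equals the number of POSITIVE eigenvalues of `H_W(U, m)`, for every
gauge field, every torus, every bare mass. -/
theorem negCount_hermitianWilson_negReflect (hρ : ∀ g, ρ g ∈ Matrix.unitaryGroup (Fin N) ℂ)
    (U : GaugeConfig 4 L G) (m : ℝ) :
    ((spinorLift gammaFive * wilsonDirac ρ U.negReflect m 1).charpoly.roots.countP
        fun z : ℂ => z.re < 0) =
      (spinorLift gammaFive * wilsonDirac ρ U m 1).charpoly.roots.countP fun z : ℂ => 0 < z.re := by
  rw [hermitianWilson_negReflect ρ hρ U m, roots_charpoly_neg]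
  have hsim : ((spinorLift (L := L) (N := N) 𝔸 * (spinorLift gammaFive * wilsonDirac ρ U m 1) *
      spinorLift (-𝔸)).submatrix θI θI).charpoly = (spinorLift gammaFive * wilsonDirac ρ U m 1).charpoly := by
    have hre : ((spinorLift (L := L) (N := N) 𝔸 * (spinorLift gammaFive * wilsonDirac ρ U m 1) *
        spinorLift (-𝔸)).submatrix θI θI) = Matrix.reindex (θI).symm (θI).symm
          (spinorLift (L := L) (N := N) 𝔸 * (spinorLift gammaFive * wilsonDirac ρ U m 1) *
            spinorLift (-𝔸)) := rfl
    rw [hre, Matrix.charpoly_reindex, Matrix.charpoly_mul_comm, ← Matrix.mul_assoc, spinorLift_mul,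
      neg_spinA_mul_spinA, spinorLift_one, Matrix.one_mul]
  rw [hsim, Multiset.countP_map, Multiset.countP_eq_card_filter]
  congr 1
  exact Multiset.filter_congr fun z _ => by simp only [Complex.neg_re, neg_lt_zero]

/-- **The fermion determinant is reflection invariant**: `det D_W(Θ'U, m) = det D_W(U, m)`. -/
theorem det_wilsonDirac_negReflect (hρ : ∀ g, ρ g ∈ Matrix.unitaryGroup (Fin N) ℂ)
    (U : GaugeConfig 4 L G) (m : ℝ) :
    (wilsonDirac ρ U.negReflect m 1).det = (wilsonDirac ρ U m 1).det := by
  rw [wilsonDirac_negReflect ρ hρ U m, Matrix.det_submatrix_equiv_self, Matrix.det_mul, Matrix.det_mul,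
    mul_right_comm, ← Matrix.det_mul, spinorLift_mul, spinA_mul_neg_spinA, spinorLift_one,
    Matrix.det_one, one_mul]

end LinkReflect

end Summit.QuantumFields.QCD.Theorems.TipPricing.Negative

end
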